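import Summits.BirchSwinnertonDyer.BirchSwinnertonDyer.Theorems.BiquadraticEisensteinDescentHeegnerTwistCouplingInSupplyLinnikCensusKOne
import HarnessLib

set_option linter.dupNamespace false -- `Summit.BirchSwinnertonDyer.BirchSwinnertonDyer.Theorems.…` (summit = sub)
set_option autoImplicit false

/-!
# Crux `HeegnerTwistCouplingInSupply` (stmt-BirchSwinnertonDyer-21381) — k = 1 pattern-free census, HEADLINE INSTANCES:
# `E_{3p}` (`p ≡ 7 (8)`), `E_{5p}` (`p ≡ 3 (8)`), `E_{7p}` (`p ≡ 3 (8)`), `E_{10p}` (`p ≡ 3 (4)`) — all but `O(log⁸ Q)` primes, mod BT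

Route `BiquadraticEisensteinDescent` (cell `pub/bsd-wall`, width seat `bsd-wall-cm-bed-w3` g19; `--supports` 21381, helper).
Instances of `…LinnikCensusKOne.kOne_allBut_two(_even)_of_BT` on the families of SIGN-TABLE-KERNEL-w3g18 §6 («E_{r₀p}, r₀ ∈ {3,5,7},
and E_{10p}: located-only recipes cover 99.7–100 % of residue classes, never all p»), with the two-slot pattern-free families found by
this seat (kernel-checked `winsPR`/`wins2PR` for both mutual symbols, by `decide`) and their slot classes mod `8r₀` (discharged by
`norm_num`/`decide`): for each family, modulo Burungale–Tian ONLY, `∃ C > 0, ∀ Q ≥ 3, ∃ E, #E ≤ C (log Q)⁸` such that EVERY prime `p` of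
the root-number `−1` class with `⌊√Q⌋ < p ≤ Q`, `p ∉ E` satisfies the conclusion of crux 21381 for `W`:

* ★ `cruxConclusion_E3p_allBut_of_BT` — `W = E_{3p}`, every `p ≡ 7 (mod 8)` (families for `(3/p) = ±1`);
* ★ `cruxConclusion_E5p_allBut_of_BT` — `W = E_{5p}`, every `p ≡ 3 (mod 8)`;
* ★ `cruxConclusion_E7p_allBut_of_BT` — `W = E_{7p}`, every `p ≡ 3 (mod 8)`;
* ★ `cruxConclusion_E10p_allBut_of_BT` — `W = E_{10p}`, every `p ≡ 3 (mod 4)` (four families: `p ≡ 3, 7 (8)` × `(5/p) = ±1`);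
* ★ `cruxConclusion_E11p_allBut_of_BT` (`p ≡ 7 (8)`), ★ `cruxConclusion_E13p_allBut_of_BT` (`p ≡ 3 (8)`) — the families depend only on
  `r₀ mod 8` and `(r₀/p)`; any further `r₀` is a 40-line instance of `kOne_allBut_two(_even)_of_BT` (table in the crux memo).

HONEST FRAMING: RUNG-LEVEL, density one in `p` with a polylog exceptional set (every individual `p` conceded), four congruent families;
the crux as stated (all CM `W`, all `p ≥ 5`; residual C⁺), its registered stubs and BSD are NOT touched; nothing is closed. THEOREMS ONLY.
-/

namespace Summit.BirchSwinnertonDyer.BirchSwinnertonDyer.Theorems.LinnikCensus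

open Finset
open Literature.NumberTheory.EllipticCurves
open Summit.BirchSwinnertonDyer.BirchSwinnertonDyer.Theorems.SymbolicMonsky

/-! ## Slot-class bookkeeping: `(q/r₀)` from `q mod 8r₀` -/

/-- `(q/3)` from `q mod 24`: classes `17, 23` are non-residues, `1, 7` residues. [folklore] -/
theorem jacobiSym_three_of_mod {q k : ℕ} (hq : q % 24 = k % 24) :
    jacobiSym (q : ℤ) 3 = jacobiSym ((k % 3 : ℕ) : ℤ) 3 := by
  rw [jacobiSym.mod_left (q : ℤ) 3, jacobiSym.mod_left ((k % 3 : ℕ) : ℤ) 3]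
  congr 1
  have h : q % 3 = k % 3 := by
    rw [← Nat.mod_mod_of_dvd q (by norm_num : 3 ∣ 24), hq, Nat.mod_mod_of_dvd k (by norm_num : 3 ∣ 24)]
  omega

/-- `(q/5)` from `q mod 40`. [folklore] -/
theorem jacobiSym_five_of_mod {q k : ℕ} (hq : q % 40 = k % 40) :
    jacobiSym (q : ℤ) 5 = jacobiSym ((k % 5 : ℕ) : ℤ) 5 := by
  rw [jacobiSym.mod_left (q : ℤ) 5, jacobiSym.mod_left ((k % 5 : ℕ) : ℤ) 5]
  congr 1
  have h : q % 5 = k % 5 := by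
    rw [← Nat.mod_mod_of_dvd q (by norm_num : 5 ∣ 40), hq, Nat.mod_mod_of_dvd k (by norm_num : 5 ∣ 40)]
  omega

/-- `(q/7)` from `q mod 56`. [folklore] -/
theorem jacobiSym_seven_of_mod {q k : ℕ} (hq : q % 56 = k % 56) :
    jacobiSym (q : ℤ) 7 = jacobiSym ((k % 7 : ℕ) : ℤ) 7 := by
  rw [jacobiSym.mod_left (q : ℤ) 7, jacobiSym.mod_left ((k % 7 : ℕ) : ℤ) 7]
  congr 1
  have h : q % 7 = k % 7 := by
    rw [← Nat.mod_mod_of_dvd q (by norm_num : 7 ∣ 56), hq, Nat.mod_mod_of_dvd k (by norm_num : 7 ∣ 56)]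
  omega

/-- For an odd prime `p ≠ r₀` (`r₀` prime): `(r₀/p) = −1` or `(r₀/p) = 1`. [folklore] -/
theorem jacobiSym_eq_neg_one_or_eq_one {r p : ℕ} (hr : r.Prime) (hp : p.Prime) (hne : r ≠ p) :
    jacobiSym (r : ℤ) p = -1 ∨ jacobiSym (r : ℤ) p = 1 := by
  have hcop : Int.gcd (r : ℤ) p = 1 := by
    rw [Int.gcd_natCast_natCast]; exact (Nat.coprime_primes hr hp).mpr hne
  rcases jacobiSym.eq_one_or_neg_one hcop with h | h
  · exact Or.inr h
  · exact Or.inl h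

/-! ## `W = E_{3p}`, `p ≡ 7 (mod 8)` -/

open scoped Classical in
/-- ★ **`E_{3p}`: the conclusion of crux 21381 for all but `O(log⁸ Q)` primes `p ≡ 7 (mod 8)`, modulo Burungale–Tian.** Families
(kernel-checked for both mutual symbols): `(3/p) = +1`: cells `(1,(·/3)=−1)`, `(7,(·/3)=+1)`, signs `(q₀/p) = +1`, `(q₁/p) = −1`, slot
classes `17, 7 (mod 24)`; `(3/p) = −1`: cells `(1,+1)`, `(7,−1)`, signs `−1, +1`, slot classes `1, 23 (mod 24)`.
[cite: BurungaleTian2026, Thm. 1.1] [cite: Montgomery1978, p. 561] [cite: MontgomeryVaughan2007, Cor. 11.17] -/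
theorem cruxConclusion_E3p_allBut_of_BT (hBT : burungaleTian_analyticRank_eq_zero_of_selmerCorank_eq_zero_of_hasCM) :
    ∃ C : ℝ, 0 < C ∧ ∀ Q : ℕ, 3 ≤ Q → ∃ E : Finset ℕ, (E.card : ℝ) ≤ C * Real.log Q ^ 8 ∧
      ∀ p : ℕ, p.Prime → p % 8 = 7 → Nat.sqrt Q < p → p ≤ Q → p ∉ E →
        ∃ (K : Type) (_ : Field K) (_ : NumberField K),
          IsImaginaryQuadratic K ∧ 4 < (NumberField.discr K).natAbs ∧
          SatisfiesHeegnerHypothesis ((congruentNumberCurve (3 * p)).conductorNorm ℤ) K ∧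
          ((congruentNumberCurve (3 * p)).quadraticTwist (NumberField.discr K : ℚ)).entireLFunction 1 ≠ 0 ∧
          ¬ p ∣ NumberField.classNumber K := by
  -- `(3/p) = +1` family
  obtain ⟨Cf, hCf, hf⟩ := kOne_allBut_two_of_BT hBT (pc := 3) (rc := 1) (rp := false) (0, true) (3, false) false true
    (by decide) (by decide) Nat.prime_three (by decide) 17 7
    ((ZMod.isUnit_iff_coprime 17 (8 * 3)).mpr (by norm_num)) ((ZMod.isUnit_iff_coprime 7 (8 * 3)).mpr (by norm_num))
    (by decide) (by decide)
    (fun q _ hq => by rw [jacobiSym_three_of_mod hq]; norm_num)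
    (fun q _ hq => by rw [jacobiSym_three_of_mod hq]; norm_num)
  -- `(3/p) = −1` family
  obtain ⟨Ct, hCt, ht⟩ := kOne_allBut_two_of_BT hBT (pc := 3) (rc := 1) (rp := true) (0, false) (3, true) true false
    (by decide) (by decide) Nat.prime_three (by decide) 1 23
    ((ZMod.isUnit_iff_coprime 1 (8 * 3)).mpr (by norm_num)) ((ZMod.isUnit_iff_coprime 23 (8 * 3)).mpr (by norm_num))
    (by decide) (by decide)
    (fun q _ hq => by rw [jacobiSym_three_of_mod hq]; norm_num)
    (fun q _ hq => by rw [jacobiSym_three_of_mod hq]; norm_num)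
  refine ⟨Cf + Ct, by positivity, fun Q hQ => ?_⟩
  obtain ⟨Ef, hEf, hpf⟩ := hf Q hQ
  obtain ⟨Et, hEt, hpt⟩ := ht Q hQ
  refine ⟨Ef ∪ Et, ?_, ?_⟩
  · calc ((Ef ∪ Et).card : ℝ) ≤ (Ef.card : ℝ) + Et.card := by exact_mod_cast Finset.card_union_le Ef Et
      _ ≤ Cf * Real.log Q ^ 8 + Ct * Real.log Q ^ 8 := add_le_add hEf hEt
      _ = (Cf + Ct) * Real.log Q ^ 8 := by ring
  intro p hp hp8 hyp hpQ hpE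
  rw [Finset.mem_union, not_or] at hpE
  rw [show 3 * p = p * 3 from Nat.mul_comm 3 p]
  have hp3 : (3 : ℕ) ≠ p := by rintro rfl; omega
  rcases jacobiSym_eq_neg_one_or_eq_one Nat.prime_three hp hp3 with h | h
  · exact hpt p hp (by simpa [clsVal] using hp8) (by rw [h]; simp) hyp hpQ hpE.2
  · exact hpf p hp (by simpa [clsVal] using hp8) (by rw [h]; simp) hyp hpQ hpE.1

/-! ## `W = E_{5p}`, `p ≡ 3 (mod 8)` -/

open scoped Classical in
/-- ★ **`E_{5p}`: the conclusion of crux 21381 for all but `O(log⁸ Q)` primes `p ≡ 3 (mod 8)`, modulo Burungale–Tian.** One family serves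
both signs of `(5/p)`: cells `(1,(·/5)=−1)`, `(7,(·/5)=−1)`, signs `(q₀/p) = +1`, `(q₁/p) = −1`, slot classes `17, 7 (mod 40)`.
[cite: BurungaleTian2026, Thm. 1.1] [cite: Montgomery1978, p. 561] [cite: MontgomeryVaughan2007, Cor. 11.17] -/
theorem cruxConclusion_E5p_allBut_of_BT (hBT : burungaleTian_analyticRank_eq_zero_of_selmerCorank_eq_zero_of_hasCM) :
    ∃ C : ℝ, 0 < C ∧ ∀ Q : ℕ, 3 ≤ Q → ∃ E : Finset ℕ, (E.card : ℝ) ≤ C * Real.log Q ^ 8 ∧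
      ∀ p : ℕ, p.Prime → p % 8 = 3 → Nat.sqrt Q < p → p ≤ Q → p ∉ E →
        ∃ (K : Type) (_ : Field K) (_ : NumberField K),
          IsImaginaryQuadratic K ∧ 4 < (NumberField.discr K).natAbs ∧
          SatisfiesHeegnerHypothesis ((congruentNumberCurve (5 * p)).conductorNorm ℤ) K ∧
          ((congruentNumberCurve (5 * p)).quadraticTwist (NumberField.discr K : ℚ)).entireLFunction 1 ≠ 0 ∧
          ¬ p ∣ NumberField.classNumber K := by
  have h5 : Nat.Prime 5 := by norm_num
  obtain ⟨Cf, hCf, hf⟩ := kOne_allBut_two_of_BT hBT (pc := 1) (rc := 2) (rp := false) (0, true) (3, true) false true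
    (by decide) (by decide) h5 (by decide) 17 7
    ((ZMod.isUnit_iff_coprime 17 (8 * 5)).mpr (by norm_num)) ((ZMod.isUnit_iff_coprime 7 (8 * 5)).mpr (by norm_num))
    (by decide) (by decide)
    (fun q _ hq => by rw [jacobiSym_five_of_mod hq]; norm_num)
    (fun q _ hq => by rw [jacobiSym_five_of_mod hq]; norm_num)
  obtain ⟨Ct, hCt, ht⟩ := kOne_allBut_two_of_BT hBT (pc := 1) (rc := 2) (rp := true) (0, true) (3, true) false true
    (by decide) (by decide) h5 (by decide) 17 7
    ((ZMod.isUnit_iff_coprime 17 (8 * 5)).mpr (by norm_num)) ((ZMod.isUnit_iff_coprime 7 (8 * 5)).mpr (by norm_num))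
    (by decide) (by decide)
    (fun q _ hq => by rw [jacobiSym_five_of_mod hq]; norm_num)
    (fun q _ hq => by rw [jacobiSym_five_of_mod hq]; norm_num)
  refine ⟨Cf + Ct, by positivity, fun Q hQ => ?_⟩
  obtain ⟨Ef, hEf, hpf⟩ := hf Q hQ
  obtain ⟨Et, hEt, hpt⟩ := ht Q hQ
  refine ⟨Ef ∪ Et, ?_, ?_⟩
  · calc ((Ef ∪ Et).card : ℝ) ≤ (Ef.card : ℝ) + Et.card := by exact_mod_cast Finset.card_union_le Ef Et
      _ ≤ Cf * Real.log Q ^ 8 + Ct * Real.log Q ^ 8 := add_le_add hEf hEt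
      _ = (Cf + Ct) * Real.log Q ^ 8 := by ring
  intro p hp hp8 hyp hpQ hpE
  rw [Finset.mem_union, not_or] at hpE
  rw [show 5 * p = p * 5 from Nat.mul_comm 5 p]
  have hp5 : (5 : ℕ) ≠ p := by rintro rfl; omega
  rcases jacobiSym_eq_neg_one_or_eq_one h5 hp hp5 with h | h
  · exact hpt p hp (by simpa [clsVal] using hp8) (by rw [h]; simp) hyp hpQ hpE.2
  · exact hpf p hp (by simpa [clsVal] using hp8) (by rw [h]; simp) hyp hpQ hpE.1

/-! ## `W = E_{7p}`, `p ≡ 3 (mod 8)` -/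

open scoped Classical in
/-- ★ **`E_{7p}`: the conclusion of crux 21381 for all but `O(log⁸ Q)` primes `p ≡ 3 (mod 8)`, modulo Burungale–Tian.** Families:
`(7/p) = +1`: cells `(1,(·/7)=−1)`, `(7,(·/7)=+1)`, signs `+1, −1`, slot classes `17, 15 (mod 56)`; `(7/p) = −1`: cells `(1,+1)`, `(7,−1)`,
signs `−1, +1`, slot classes `1, 31 (mod 56)`. [cite: BurungaleTian2026, Thm. 1.1] [cite: Montgomery1978, p. 561]
[cite: MontgomeryVaughan2007, Cor. 11.17] -/
theorem cruxConclusion_E7p_allBut_of_BT (hBT : burungaleTian_analyticRank_eq_zero_of_selmerCorank_eq_zero_of_hasCM) :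
    ∃ C : ℝ, 0 < C ∧ ∀ Q : ℕ, 3 ≤ Q → ∃ E : Finset ℕ, (E.card : ℝ) ≤ C * Real.log Q ^ 8 ∧
      ∀ p : ℕ, p.Prime → p % 8 = 3 → Nat.sqrt Q < p → p ≤ Q → p ∉ E →
        ∃ (K : Type) (_ : Field K) (_ : NumberField K),
          IsImaginaryQuadratic K ∧ 4 < (NumberField.discr K).natAbs ∧
          SatisfiesHeegnerHypothesis ((congruentNumberCurve (7 * p)).conductorNorm ℤ) K ∧
          ((congruentNumberCurve (7 * p)).quadraticTwist (NumberField.discr K : ℚ)).entireLFunction 1 ≠ 0 ∧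
          ¬ p ∣ NumberField.classNumber K := by
  have h7 : Nat.Prime 7 := by norm_num
  obtain ⟨Cf, hCf, hf⟩ := kOne_allBut_two_of_BT hBT (pc := 1) (rc := 3) (rp := false) (0, true) (3, false) false true
    (by decide) (by decide) h7 (by decide) 17 15
    ((ZMod.isUnit_iff_coprime 17 (8 * 7)).mpr (by norm_num)) ((ZMod.isUnit_iff_coprime 15 (8 * 7)).mpr (by norm_num))
    (by decide) (by decide)
    (fun q _ hq => by rw [jacobiSym_seven_of_mod hq]; norm_num)
    (fun q _ hq => by rw [jacobiSym_seven_of_mod hq]; norm_num)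
  obtain ⟨Ct, hCt, ht⟩ := kOne_allBut_two_of_BT hBT (pc := 1) (rc := 3) (rp := true) (0, false) (3, true) true false
    (by decide) (by decide) h7 (by decide) 1 31
    ((ZMod.isUnit_iff_coprime 1 (8 * 7)).mpr (by norm_num)) ((ZMod.isUnit_iff_coprime 31 (8 * 7)).mpr (by norm_num))
    (by decide) (by decide)
    (fun q _ hq => by rw [jacobiSym_seven_of_mod hq]; norm_num)
    (fun q _ hq => by rw [jacobiSym_seven_of_mod hq]; norm_num)
  refine ⟨Cf + Ct, by positivity, fun Q hQ => ?_⟩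
  obtain ⟨Ef, hEf, hpf⟩ := hf Q hQ
  obtain ⟨Et, hEt, hpt⟩ := ht Q hQ
  refine ⟨Ef ∪ Et, ?_, ?_⟩
  · calc ((Ef ∪ Et).card : ℝ) ≤ (Ef.card : ℝ) + Et.card := by exact_mod_cast Finset.card_union_le Ef Et
      _ ≤ Cf * Real.log Q ^ 8 + Ct * Real.log Q ^ 8 := add_le_add hEf hEt
      _ = (Cf + Ct) * Real.log Q ^ 8 := by ring
  intro p hp hp8 hyp hpQ hpE
  rw [Finset.mem_union, not_or] at hpE
  rw [show 7 * p = p * 7 from Nat.mul_comm 7 p]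
  have hp7 : (7 : ℕ) ≠ p := by rintro rfl; omega
  rcases jacobiSym_eq_neg_one_or_eq_one h7 hp hp7 with h | h
  · exact hpt p hp (by simpa [clsVal] using hp8) (by rw [h]; simp) hyp hpQ hpE.2
  · exact hpf p hp (by simpa [clsVal] using hp8) (by rw [h]; simp) hyp hpQ hpE.1

/-! ## `W = E_{10p}`, `p ≡ 3 (mod 4)` -/

open scoped Classical in
/-- ★ **`E_{10p}`: the conclusion of crux 21381 for all but `O(log⁸ Q)` primes `p ≡ 3 (mod 4)`, modulo Burungale–Tian** — four families
on the even base `E_{2·5·p}`: `p ≡ 3 (8)` (either `(5/p)`): cells `(1,(·/5)=+1)`, `(7,(·/5)=+1)`, signs `−1, +1`, slots `1, 31 (mod 40)`;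
`p ≡ 7 (8)`, `(5/p) = +1`: cells `(1,−1)`, `(7,−1)`, signs `+1, −1`, slots `17, 7`; `p ≡ 7 (8)`, `(5/p) = −1`: cells `(1,+1)`, `(7,+1)`,
signs `−1, +1`, slots `1, 31`. [cite: BurungaleTian2026, Thm. 1.1] [cite: Montgomery1978, p. 561] [cite: MontgomeryVaughan2007, Cor. 11.17] -/
theorem cruxConclusion_E10p_allBut_of_BT (hBT : burungaleTian_analyticRank_eq_zero_of_selmerCorank_eq_zero_of_hasCM) :
    ∃ C : ℝ, 0 < C ∧ ∀ Q : ℕ, 3 ≤ Q → ∃ E : Finset ℕ, (E.card : ℝ) ≤ C * Real.log Q ^ 8 ∧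
      ∀ p : ℕ, p.Prime → p % 4 = 3 → Nat.sqrt Q < p → p ≤ Q → p ∉ E →
        ∃ (K : Type) (_ : Field K) (_ : NumberField K),
          IsImaginaryQuadratic K ∧ 4 < (NumberField.discr K).natAbs ∧
          SatisfiesHeegnerHypothesis ((congruentNumberCurve (10 * p)).conductorNorm ℤ) K ∧
          ((congruentNumberCurve (10 * p)).quadraticTwist (NumberField.discr K : ℚ)).entireLFunction 1 ≠ 0 ∧
          ¬ p ∣ NumberField.classNumber K := by
  have h5 : Nat.Prime 5 := by norm_num
  -- `p ≡ 3 (8)`, both `(5/p)`: cells (0,false),(3,false), signs true,false, slots 1, 31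
  obtain ⟨C3f, hC3f, h3f⟩ := kOne_allBut_two_even_of_BT hBT (pc := 1) (rc := 2) (rp := false) (0, false) (3, false) true false
    (by decide) (by decide) h5 (by decide) 1 31
    ((ZMod.isUnit_iff_coprime 1 (8 * 5)).mpr (by norm_num)) ((ZMod.isUnit_iff_coprime 31 (8 * 5)).mpr (by norm_num))
    (by decide) (by decide)
    (fun q _ hq => by rw [jacobiSym_five_of_mod hq]; norm_num)
    (fun q _ hq => by rw [jacobiSym_five_of_mod hq]; norm_num)
  obtain ⟨C3t, hC3t, h3t⟩ := kOne_allBut_two_even_of_BT hBT (pc := 1) (rc := 2) (rp := true) (0, false) (3, false) true false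
    (by decide) (by decide) h5 (by decide) 1 31
    ((ZMod.isUnit_iff_coprime 1 (8 * 5)).mpr (by norm_num)) ((ZMod.isUnit_iff_coprime 31 (8 * 5)).mpr (by norm_num))
    (by decide) (by decide)
    (fun q _ hq => by rw [jacobiSym_five_of_mod hq]; norm_num)
    (fun q _ hq => by rw [jacobiSym_five_of_mod hq]; norm_num)
  -- `p ≡ 7 (8)`, `(5/p) = +1`: cells (0,true),(3,true), signs false,true, slots 17, 7
  obtain ⟨C7f, hC7f, h7f⟩ := kOne_allBut_two_even_of_BT hBT (pc := 3) (rc := 2) (rp := false) (0, true) (3, true) false true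
    (by decide) (by decide) h5 (by decide) 17 7
    ((ZMod.isUnit_iff_coprime 17 (8 * 5)).mpr (by norm_num)) ((ZMod.isUnit_iff_coprime 7 (8 * 5)).mpr (by norm_num))
    (by decide) (by decide)
    (fun q _ hq => by rw [jacobiSym_five_of_mod hq]; norm_num)
    (fun q _ hq => by rw [jacobiSym_five_of_mod hq]; norm_num)
  -- `p ≡ 7 (8)`, `(5/p) = −1`: cells (0,false),(3,false), signs true,false, slots 1, 31
  obtain ⟨C7t, hC7t, h7t⟩ := kOne_allBut_two_even_of_BT hBT (pc := 3) (rc := 2) (rp := true) (0, false) (3, false) true false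
    (by decide) (by decide) h5 (by decide) 1 31
    ((ZMod.isUnit_iff_coprime 1 (8 * 5)).mpr (by norm_num)) ((ZMod.isUnit_iff_coprime 31 (8 * 5)).mpr (by norm_num))
    (by decide) (by decide)
    (fun q _ hq => by rw [jacobiSym_five_of_mod hq]; norm_num)
    (fun q _ hq => by rw [jacobiSym_five_of_mod hq]; norm_num)
  refine ⟨C3f + C3t + C7f + C7t, by positivity, fun Q hQ => ?_⟩
  obtain ⟨E3f, hE3f, hp3f⟩ := h3f Q hQ
  obtain ⟨E3t, hE3t, hp3t⟩ := h3t Q hQ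
  obtain ⟨E7f, hE7f, hp7f⟩ := h7f Q hQ
  obtain ⟨E7t, hE7t, hp7t⟩ := h7t Q hQ
  refine ⟨(E3f ∪ E3t) ∪ (E7f ∪ E7t), ?_, ?_⟩
  · have h1 : (((E3f ∪ E3t) ∪ (E7f ∪ E7t)).card : ℝ) ≤ ((E3f.card : ℝ) + E3t.card) + (E7f.card + E7t.card) := by
      have a := Finset.card_union_le (E3f ∪ E3t) (E7f ∪ E7t)
      have b := Finset.card_union_le E3f E3t
      have c := Finset.card_union_le E7f E7t
      exact_mod_cast a.trans (Nat.add_le_add b c)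
    calc _ ≤ ((E3f.card : ℝ) + E3t.card) + (E7f.card + E7t.card) := h1
      _ ≤ (C3f * Real.log Q ^ 8 + C3t * Real.log Q ^ 8) + (C7f * Real.log Q ^ 8 + C7t * Real.log Q ^ 8) :=
          add_le_add (add_le_add hE3f hE3t) (add_le_add hE7f hE7t)
      _ = (C3f + C3t + C7f + C7t) * Real.log Q ^ 8 := by ring
  intro p hp hp4 hyp hpQ hpE
  simp only [Finset.mem_union, not_or] at hpE
  obtain ⟨⟨hn3f, hn3t⟩, hn7f, hn7t⟩ := hpE
  rw [show 10 * p = 2 * (p * 5) by ring]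
  have hp5 : (5 : ℕ) ≠ p := by rintro rfl; omega
  have hp8 : p % 8 = 3 ∨ p % 8 = 7 := by omega
  rcases hp8 with hp8 | hp8 <;> rcases jacobiSym_eq_neg_one_or_eq_one h5 hp hp5 with h | h
  · exact hp3t p hp (by simpa [clsVal] using hp8) (by rw [h]; simp) hyp hpQ hn3t
  · exact hp3f p hp (by simpa [clsVal] using hp8) (by rw [h]; simp) hyp hpQ hn3f
  · exact hp7t p hp (by simpa [clsVal] using hp8) (by rw [h]; simp) hyp hpQ hn7t
  · exact hp7f p hp (by simpa [clsVal] using hp8) (by rw [h]; simp) hyp hpQ hn7f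

/-! ## `W = E_{11p}` (`p ≡ 7 (mod 8)`) and `W = E_{13p}` (`p ≡ 3 (mod 8)`) — same families as `r₀ = 3`, `5` (classes `r₀ mod 8`) -/

/-- `(q/11)` from `q mod 88`. [folklore] -/
theorem jacobiSym_eleven_of_mod {q k : ℕ} (hq : q % 88 = k % 88) :
    jacobiSym (q : ℤ) 11 = jacobiSym ((k % 11 : ℕ) : ℤ) 11 := by
  rw [jacobiSym.mod_left (q : ℤ) 11, jacobiSym.mod_left ((k % 11 : ℕ) : ℤ) 11]
  congr 1
  have h : q % 11 = k % 11 := by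
    rw [← Nat.mod_mod_of_dvd q (by norm_num : 11 ∣ 88), hq, Nat.mod_mod_of_dvd k (by norm_num : 11 ∣ 88)]
  omega

/-- `(q/13)` from `q mod 104`. [folklore] -/
theorem jacobiSym_thirteen_of_mod {q k : ℕ} (hq : q % 104 = k % 104) :
    jacobiSym (q : ℤ) 13 = jacobiSym ((k % 13 : ℕ) : ℤ) 13 := by
  rw [jacobiSym.mod_left (q : ℤ) 13, jacobiSym.mod_left ((k % 13 : ℕ) : ℤ) 13]
  congr 1
  have h : q % 13 = k % 13 := by
    rw [← Nat.mod_mod_of_dvd q (by norm_num : 13 ∣ 104), hq, Nat.mod_mod_of_dvd k (by norm_num : 13 ∣ 104)]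
  omega

open scoped Classical in
/-- ★ **`E_{11p}`: the conclusion of crux 21381 for all but `O(log⁸ Q)` primes `p ≡ 7 (mod 8)`, modulo Burungale–Tian** (families of the
class `r₀ ≡ 3 (mod 8)`: `(11/p) = +1`: cells `(1,−),(7,+)`, signs `+,−`, slots `17, 15 (mod 88)`; `(11/p) = −1`: cells `(1,+),(7,−)`, signs
`−,+`, slots `1, 7 (mod 88)`). [cite: BurungaleTian2026, Thm. 1.1] [cite: Montgomery1978, p. 561] [cite: MontgomeryVaughan2007, Cor. 11.17] -/
theorem cruxConclusion_E11p_allBut_of_BT (hBT : burungaleTian_analyticRank_eq_zero_of_selmerCorank_eq_zero_of_hasCM) :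
    ∃ C : ℝ, 0 < C ∧ ∀ Q : ℕ, 3 ≤ Q → ∃ E : Finset ℕ, (E.card : ℝ) ≤ C * Real.log Q ^ 8 ∧
      ∀ p : ℕ, p.Prime → p % 8 = 7 → Nat.sqrt Q < p → p ≤ Q → p ∉ E →
        ∃ (K : Type) (_ : Field K) (_ : NumberField K),
          IsImaginaryQuadratic K ∧ 4 < (NumberField.discr K).natAbs ∧
          SatisfiesHeegnerHypothesis ((congruentNumberCurve (11 * p)).conductorNorm ℤ) K ∧
          ((congruentNumberCurve (11 * p)).quadraticTwist (NumberField.discr K : ℚ)).entireLFunction 1 ≠ 0 ∧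
          ¬ p ∣ NumberField.classNumber K := by
  have h11 : Nat.Prime 11 := by norm_num
  obtain ⟨Cf, hCf, hf⟩ := kOne_allBut_two_of_BT hBT (pc := 3) (rc := 1) (rp := false) (0, true) (3, false) false true
    (by decide) (by decide) h11 (by decide) 17 15
    ((ZMod.isUnit_iff_coprime 17 (8 * 11)).mpr (by norm_num)) ((ZMod.isUnit_iff_coprime 15 (8 * 11)).mpr (by norm_num))
    (by decide) (by decide)
    (fun q _ hq => by rw [jacobiSym_eleven_of_mod hq]; norm_num)
    (fun q _ hq => by rw [jacobiSym_eleven_of_mod hq]; norm_num)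
  obtain ⟨Ct, hCt, ht⟩ := kOne_allBut_two_of_BT hBT (pc := 3) (rc := 1) (rp := true) (0, false) (3, true) true false
    (by decide) (by decide) h11 (by decide) 1 7
    ((ZMod.isUnit_iff_coprime 1 (8 * 11)).mpr (by norm_num)) ((ZMod.isUnit_iff_coprime 7 (8 * 11)).mpr (by norm_num))
    (by decide) (by decide)
    (fun q _ hq => by rw [jacobiSym_eleven_of_mod hq]; norm_num)
    (fun q _ hq => by rw [jacobiSym_eleven_of_mod hq]; norm_num)
  refine ⟨Cf + Ct, by positivity, fun Q hQ => ?_⟩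
  obtain ⟨Ef, hEf, hpf⟩ := hf Q hQ
  obtain ⟨Et, hEt, hpt⟩ := ht Q hQ
  refine ⟨Ef ∪ Et, ?_, ?_⟩
  · calc ((Ef ∪ Et).card : ℝ) ≤ (Ef.card : ℝ) + Et.card := by exact_mod_cast Finset.card_union_le Ef Et
      _ ≤ Cf * Real.log Q ^ 8 + Ct * Real.log Q ^ 8 := add_le_add hEf hEt
      _ = (Cf + Ct) * Real.log Q ^ 8 := by ring
  intro p hp hp8 hyp hpQ hpE
  rw [Finset.mem_union, not_or] at hpE
  rw [show 11 * p = p * 11 from Nat.mul_comm 11 p]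
  have hp11 : (11 : ℕ) ≠ p := by rintro rfl; omega
  rcases jacobiSym_eq_neg_one_or_eq_one h11 hp hp11 with h | h
  · exact hpt p hp (by simpa [clsVal] using hp8) (by rw [h]; simp) hyp hpQ hpE.2
  · exact hpf p hp (by simpa [clsVal] using hp8) (by rw [h]; simp) hyp hpQ hpE.1

open scoped Classical in
/-- ★ **`E_{13p}`: the conclusion of crux 21381 for all but `O(log⁸ Q)` primes `p ≡ 3 (mod 8)`, modulo Burungale–Tian** (family of the
class `r₀ ≡ 5 (mod 8)`: cells `(1,−),(7,−)`, signs `+,−`, slots `33, 7 (mod 104)`, both `(13/p)`).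
[cite: BurungaleTian2026, Thm. 1.1] [cite: Montgomery1978, p. 561] [cite: MontgomeryVaughan2007, Cor. 11.17] -/
theorem cruxConclusion_E13p_allBut_of_BT (hBT : burungaleTian_analyticRank_eq_zero_of_selmerCorank_eq_zero_of_hasCM) :
    ∃ C : ℝ, 0 < C ∧ ∀ Q : ℕ, 3 ≤ Q → ∃ E : Finset ℕ, (E.card : ℝ) ≤ C * Real.log Q ^ 8 ∧
      ∀ p : ℕ, p.Prime → p % 8 = 3 → Nat.sqrt Q < p → p ≤ Q → p ∉ E →
        ∃ (K : Type) (_ : Field K) (_ : NumberField K),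
          IsImaginaryQuadratic K ∧ 4 < (NumberField.discr K).natAbs ∧
          SatisfiesHeegnerHypothesis ((congruentNumberCurve (13 * p)).conductorNorm ℤ) K ∧
          ((congruentNumberCurve (13 * p)).quadraticTwist (NumberField.discr K : ℚ)).entireLFunction 1 ≠ 0 ∧
          ¬ p ∣ NumberField.classNumber K := by
  have h13 : Nat.Prime 13 := by norm_num
  obtain ⟨Cf, hCf, hf⟩ := kOne_allBut_two_of_BT hBT (pc := 1) (rc := 2) (rp := false) (0, true) (3, true) false true
    (by decide) (by decide) h13 (by decide) 33 7
    ((ZMod.isUnit_iff_coprime 33 (8 * 13)).mpr (by norm_num)) ((ZMod.isUnit_iff_coprime 7 (8 * 13)).mpr (by norm_num))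
    (by decide) (by decide)
    (fun q _ hq => by rw [jacobiSym_thirteen_of_mod hq]; norm_num)
    (fun q _ hq => by rw [jacobiSym_thirteen_of_mod hq]; norm_num)
  obtain ⟨Ct, hCt, ht⟩ := kOne_allBut_two_of_BT hBT (pc := 1) (rc := 2) (rp := true) (0, true) (3, true) false true
    (by decide) (by decide) h13 (by decide) 33 7
    ((ZMod.isUnit_iff_coprime 33 (8 * 13)).mpr (by norm_num)) ((ZMod.isUnit_iff_coprime 7 (8 * 13)).mpr (by norm_num))
    (by decide) (by decide)
    (fun q _ hq => by rw [jacobiSym_thirteen_of_mod hq]; norm_num)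
    (fun q _ hq => by rw [jacobiSym_thirteen_of_mod hq]; norm_num)
  refine ⟨Cf + Ct, by positivity, fun Q hQ => ?_⟩
  obtain ⟨Ef, hEf, hpf⟩ := hf Q hQ
  obtain ⟨Et, hEt, hpt⟩ := ht Q hQ
  refine ⟨Ef ∪ Et, ?_, ?_⟩
  · calc ((Ef ∪ Et).card : ℝ) ≤ (Ef.card : ℝ) + Et.card := by exact_mod_cast Finset.card_union_le Ef Et
      _ ≤ Cf * Real.log Q ^ 8 + Ct * Real.log Q ^ 8 := add_le_add hEf hEt
      _ = (Cf + Ct) * Real.log Q ^ 8 := by ring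
  intro p hp hp8 hyp hpQ hpE
  rw [Finset.mem_union, not_or] at hpE
  rw [show 13 * p = p * 13 from Nat.mul_comm 13 p]
  have hp13 : (13 : ℕ) ≠ p := by rintro rfl; omega
  rcases jacobiSym_eq_neg_one_or_eq_one h13 hp hp13 with h | h
  · exact hpt p hp (by simpa [clsVal] using hp8) (by rw [h]; simp) hyp hpQ hpE.2
  · exact hpf p hp (by simpa [clsVal] using hp8) (by rw [h]; simp) hyp hpQ hpE.1

end Summit.BirchSwinnertonDyer.BirchSwinnertonDyer.Theorems.LinnikCensus
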